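import Summits.QuantumFields.YangMills.Theorems.VirialFluxGapCentralMassMonotonicity
import HarnessLib

/-!
# Route `VirialFluxGap` (YangMills): (P4) FOR THE EXPLICIT CENTRAL FIELD IN PACKAGE SHAPE — the smallness `|z|² ≤ ½` of the block averages
# follows from the central window (`mass ≤ ¼`, `F_fix ≤ (110000·L⁴)⁻¹`), so (P4) holds with `N = 330L²` on the closed `ρ`-central window (`ρ ≤ ½`)

Toward the deciding crux `VirialFluxGap.PeriodicSoftness` (item stmt-QuantumFields-24141).  ✓`central_linkMass_bracket_lower` ∕
✓`central_seamMass_bracket_lower` (Part `…CentralMassMonotonicity`) carry the hypothesis `|z_k|² ≤ ½` (resp. `|z₄|² ≤ ½`) on the wrap-block ∕ seam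
averages.  On the central window it is automatic: `|Im q(w_k)|² = m_k ≤ ¼` and `|z_k − Im q(w_k)| ≤ ‖q(w_k) − liftQuat σ_k z_k‖ ≤ 66L²√F_fix ≤ 1/5`
(w3 ✓`norm_sq_wrapRep_sub_lift_blockIm_le`) give `|z_k|² ≤ ¼ + 2·½·⅕ + 1/25 = 0.49`.

* `normSq_im_le_of_mass`, `blockIm_sq_le_half_of_window`, `seamIm_sq_le_half_of_window`;
* ★★ `central_linkMass_bracket_lower_window` ∕ ★★ `central_seamMass_bracket_lower_window` — (P4) for `centralCoeff L σ σ₄` under: sign hypothesis,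
  mass `≤ ¼`, `F_fix ≤ (110000·L⁴)⁻¹`; i.e. hypothesis (P4) of ✓`periodicSoftness_of_signPlug` with `N = 330L²`, any `ρ ≤ ½`, `t_C ≤ (110000L⁴)⁻¹`.

HONEST LABEL: one hypothesis ((P4)) of a CONDITIONAL assembly discharged for the explicit field; (P2), (P3) remain (w3 lineage); nothing is closed;
⟨24141⟩, ⟨22884⟩ remain OPEN; the Yang–Mills mass gap is NOT proved; no summit is proved by a line.  THEOREMS ONLY (0 `def`, 0 `sorry`), standard
axioms.  Explicit-unit seat `ym-line-fcl-p3` g41 (cell ym-idea-1, free hands; assembler), `--supports stmt-QuantumFields-24141`.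
References: [cite: Luscher1983, §2]; [cite: CosteEtAl1985]; [folklore].
-/

set_option autoImplicit false

noncomputable section

open scoped Matrix BigOperators ContDiff Topology Quaternion
open MeasureTheory Set Matrix
open Literature.MathematicalPhysics.QuantumFieldTheory hiding SU2
open Literature.MathematicalPhysics.QuantumLattice
open Literature.MathematicalPhysics.QuantumFieldTheory.SUNBakryEmery (expSU coe_expSU matTop)

namespace Summit.QuantumFields.YangMills.Theorems.VirialFluxGap.FrameHessian

open Summit.QuantumFields.YangMills.Theorems.FemtoTransferGap
open Summit.QuantumFields.YangMills.Theorems.FemtoTransferGap.TT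
open Summit.QuantumFields.YangMills.Theorems.FemtoTransferGap.TwoLattice
open Summit.QuantumFields.YangMills.Theorems.FemtoTransferGap.TwoLattice.Flat
open Summit.QuantumFields.YangMills.Theorems.VirialFluxGap.RingDeficit
open Summit.QuantumFields.YangMills.Theorems.VirialFluxGap.FrameDerivative
open Summit.QuantumFields.YangMills.Theorems.ToronValleyVolume.Lojasiewicz
open Summit.QuantumFields.YangMills.Theorems.VirialFluxGap.FixFrame
open Summit.QuantumFields.YangMills.Theorems.VirialFluxGap.RegCutoff
open Summit.QuantumFields.YangMills.Theorems.VirialFluxGap.CentralField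
open Summit.QuantumFields.YangMills.Theorems.VirialFluxGap.CentralCoercivity

variable {L : ℕ} [NeZero L]

open scoped Matrix.Norms.Frobenius

/-! ## §1 The block averages are small on the central window -/

omit [NeZero L] in
/-- Triangle letter in `ℝ³`: if `|a|² ≤ ¼` and `‖(b₀; a − z)‖² ≤ (1/5)²`-type control of `a − z`, then `|z|² ≤ ½`; stated as:
`Σ a_i² ≤ ¼`, `Σ (a_i − z_i)² ≤ 1/25` ⇒ `Σ z_i² ≤ ½`. [folklore] -/
theorem sq3_le_half {a₁ a₂ a₃ z₁ z₂ z₃ : ℝ} (ha : a₁ ^ 2 + a₂ ^ 2 + a₃ ^ 2 ≤ 1 / 4)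
    (hd : (a₁ - z₁) ^ 2 + (a₂ - z₂) ^ 2 + (a₃ - z₃) ^ 2 ≤ 1 / 25) : z₁ ^ 2 + z₂ ^ 2 + z₃ ^ 2 ≤ 1 / 2 := by
  -- `z = a − d`, `|z|² = |a|² − 2a·d + |d|² ≤ ¼ + 2·√(¼·1/25) + 1/25 = 0.49`
  have hcs := Literature.Geometry.Lorentzian.Kerr.sq_dot_le_three a₁ a₂ a₃ (a₁ - z₁) (a₂ - z₂) (a₃ - z₃)
  have hprod : (a₁ ^ 2 + a₂ ^ 2 + a₃ ^ 2) * ((a₁ - z₁) ^ 2 + (a₂ - z₂) ^ 2 + (a₃ - z₃) ^ 2) ≤ (1 / 10) ^ 2 := by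
    have h0 : 0 ≤ a₁ ^ 2 + a₂ ^ 2 + a₃ ^ 2 := by positivity
    have h1 : 0 ≤ (a₁ - z₁) ^ 2 + (a₂ - z₂) ^ 2 + (a₃ - z₃) ^ 2 := by positivity
    calc _ ≤ (1 / 4 : ℝ) * (1 / 25) := mul_le_mul ha hd h1 (by norm_num)
      _ = (1 / 10) ^ 2 := by norm_num
  have hdot : |a₁ * (a₁ - z₁) + a₂ * (a₂ - z₂) + a₃ * (a₃ - z₃)| ≤ 1 / 10 :=
    abs_le_of_sq_le_sq (hcs.trans hprod) (by norm_num)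
  have hdot' := (abs_le.1 hdot).1
  have e : z₁ ^ 2 + z₂ ^ 2 + z₃ ^ 2 = (a₁ ^ 2 + a₂ ^ 2 + a₃ ^ 2) - 2 * (a₁ * (a₁ - z₁) + a₂ * (a₂ - z₂) + a₃ * (a₃ - z₃)) +
      ((a₁ - z₁) ^ 2 + (a₂ - z₂) ^ 2 + (a₃ - z₃) ^ 2) := by ring
  rw [e]
  linarith

/-- The imaginary part of a unit quaternion has squared norm equal to the mass `1 − Re²`. [folklore] -/
theorem im_sq_eq_mass (U : SU2) :
    (su2Quat U).imI ^ 2 + (su2Quat U).imJ ^ 2 + (su2Quat U).imK ^ 2 = 1 - (su2Quat U).re ^ 2 := by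
  have h1 : Quaternion.normSq (su2Quat U) = 1 := normSq_su2Quat U
  rw [Quaternion.normSq_def'] at h1
  have h1' : (su2Quat U).re ^ 2 + (su2Quat U).imI ^ 2 + (su2Quat U).imJ ^ 2 + (su2Quat U).imK ^ 2 = 1 := by
    simpa only [sq] using h1
  linarith

/-- On the window `F_fix ≤ (110000·L⁴)⁻¹`: `66·L²·√F_fix ≤ 1/5`. [folklore] -/
theorem window_sqrt_le {F : ℝ} (hF : F ≤ (110000 * (L : ℝ) ^ 4)⁻¹) : 66 * (L : ℝ) ^ 2 * Real.sqrt F ≤ 1 / 5 := by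
  have hL1 : (1 : ℝ) ≤ L := by exact_mod_cast NeZero.one_le
  have hL2 : 0 < (L : ℝ) ^ 2 := by positivity
  have h1 : Real.sqrt F ≤ Real.sqrt ((110000 * (L : ℝ) ^ 4)⁻¹) := Real.sqrt_le_sqrt hF
  have h2 : Real.sqrt ((110000 * (L : ℝ) ^ 4)⁻¹) ≤ 1 / (330 * (L : ℝ) ^ 2) := by
    rw [Real.sqrt_le_left (by positivity)]
    rw [div_pow, one_pow, inv_eq_one_div, div_le_div_iff₀ (by positivity) (by positivity)]
    nlinarith [hL2]
  calc 66 * (L : ℝ) ^ 2 * Real.sqrt F ≤ 66 * (L : ℝ) ^ 2 * (1 / (330 * (L : ℝ) ^ 2)) := mul_le_mul_of_nonneg_left (h1.trans h2) (by positivity)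
    _ = 1 / 5 := by field_simp; ring

/-- ★ **The wrap-block average is small on the central window**: at an `X_fix` point with `m_k ≤ ¼`, `½ ≤ σ_k·Re q(w_k)` and
`F_fix ≤ (110000·L⁴)⁻¹`, `|z_k|² ≤ ½`. [cite: CosteEtAl1985] -/
theorem blockIm_sq_le_half_of_window {σ : ℝ} (hσ : σ = 1 ∨ σ = -1)
    (x : (OffIdx L → SU2) × ((Fin (2 * L - 1) → GaugeConfig 3 L SU2) × (Site 3 L → SU2))) (k : Fin 3)
    (hhem : (1 / 2 : ℝ) ≤ σ * (su2Quat (wrapReps ((Fin.cons (glue x.1) x.2.1 : Fin (2 * L - 1 + 1) → GaugeConfig 3 L SU2) 0) k)).re)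
    (hmass : 1 - (su2Quat (wrapReps ((Fin.cons (glue x.1) x.2.1 : Fin (2 * L - 1 + 1) → GaugeConfig 3 L SU2) 0) k)).re ^ 2 ≤ 1 / 4)
    (hF : ringDeficit L (fun _ => false) ((Fin.cons (glue x.1) x.2.1 : Fin (2 * L - 1 + 1) → GaugeConfig 3 L SU2), x.2.2) ≤ (110000 * (L : ℝ) ^ 4)⁻¹) :
    (blockIm L (wrapBlock L k) k ((Fin.cons (glue x.1) x.2.1 : Fin (2 * L - 1 + 1) → GaugeConfig 3 L SU2), x.2.2) 0) ^ 2 +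
      (blockIm L (wrapBlock L k) k ((Fin.cons (glue x.1) x.2.1 : Fin (2 * L - 1 + 1) → GaugeConfig 3 L SU2), x.2.2) 1) ^ 2 +
      (blockIm L (wrapBlock L k) k ((Fin.cons (glue x.1) x.2.1 : Fin (2 * L - 1 + 1) → GaugeConfig 3 L SU2), x.2.2) 2) ^ 2 ≤ 1 / 2 := by
  set P : (Fin (2 * L - 1 + 1) → GaugeConfig 3 L SU2) × (Site 3 L → SU2) :=
    ((Fin.cons (glue x.1) x.2.1 : Fin (2 * L - 1 + 1) → GaugeConfig 3 L SU2), x.2.2) with hPdef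
  set z := blockIm L (wrapBlock L k) k P with hzdef
  have hP0 : P.1 0 = glue x.1 := by simp [hPdef]
  have ht : treeGauge (P.1 0) = 1 := by rw [hP0]; funext y; exact treeGauge_glue x.1 y
  set q := su2Quat (wrapReps (P.1 0) k) with hqdef
  have hprox := norm_sq_wrapRep_sub_lift_blockIm_le P ht hσ k hhem
  have hF0 : 0 ≤ ringDeficit L (fun _ => false) P := ringDeficit_nonneg _ _
  have hw := window_sqrt_le (L := L) hF
  -- `‖q − lift‖ ≤ 66L²√F ≤ 1/5`
  have hn : ‖q - liftQuat σ z‖ ≤ 1 / 5 := by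
    have h2 : ‖q - liftQuat σ z‖ ^ 2 ≤ (Real.sqrt 17 * (16 * (L : ℝ) ^ 2 * Real.sqrt (ringDeficit L (fun _ => false) P))) ^ 2 := by
      rw [mul_pow, Real.sq_sqrt (by norm_num)]; exact hprox
    have h3 := (pow_le_pow_iff_left₀ (norm_nonneg _) (by positivity) two_ne_zero).1 h2
    have h66 := sqrt17_bounds.1
    have hs0 : 0 ≤ (L : ℝ) ^ 2 * Real.sqrt (ringDeficit L (fun _ => false) P) := by positivity
    nlinarith [h3, h66, hs0, hw]
  -- components of the difference
  have him := im_sub_sq_le_norm_sub_sq q (liftQuat σ z)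
  have hd : ((su2Quat (wrapReps (P.1 0) k)).imI - z 0) ^ 2 + ((su2Quat (wrapReps (P.1 0) k)).imJ - z 1) ^ 2 +
      ((su2Quat (wrapReps (P.1 0) k)).imK - z 2) ^ 2 ≤ 1 / 25 := by
    have h5 : ‖q - liftQuat σ z‖ ^ 2 ≤ (1 / 5) ^ 2 := pow_le_pow_left₀ (norm_nonneg _) hn 2
    have e1 : (liftQuat σ z).imI = z 0 := rfl
    have e2 : (liftQuat σ z).imJ = z 1 := rfl
    have e3 : (liftQuat σ z).imK = z 2 := rfl
    rw [e1, e2, e3] at him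
    linarith
  have ha : (su2Quat (wrapReps (P.1 0) k)).imI ^ 2 + (su2Quat (wrapReps (P.1 0) k)).imJ ^ 2 + (su2Quat (wrapReps (P.1 0) k)).imK ^ 2 ≤ 1 / 4 := by
    rw [im_sq_eq_mass]; exact hmass
  exact sq3_le_half ha hd

/-- ★ **The seam average is small on the central window**: `m_seam ≤ ¼`, `½ ≤ σ₄·Re q(seam root)`, `F_fix ≤ (110000·L⁴)⁻¹` ⇒ `|z₄|² ≤ ½`. [cite: CosteEtAl1985] -/
theorem seamIm_sq_le_half_of_window {σ₄ : ℝ} (hσ₄ : σ₄ = 1 ∨ σ₄ = -1)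
    (x : (OffIdx L → SU2) × ((Fin (2 * L - 1) → GaugeConfig 3 L SU2) × (Site 3 L → SU2)))
    (hhem : (1 / 2 : ℝ) ≤ σ₄ * (su2Quat (x.2.2 0)).re) (hmass : 1 - (su2Quat (x.2.2 0)).re ^ 2 ≤ 1 / 4)
    (hF : ringDeficit L (fun _ => false) ((Fin.cons (glue x.1) x.2.1 : Fin (2 * L - 1 + 1) → GaugeConfig 3 L SU2), x.2.2) ≤ (110000 * (L : ℝ) ^ 4)⁻¹) :
    (seamIm L ((Fin.cons (glue x.1) x.2.1 : Fin (2 * L - 1 + 1) → GaugeConfig 3 L SU2), x.2.2) 0) ^ 2 +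
      (seamIm L ((Fin.cons (glue x.1) x.2.1 : Fin (2 * L - 1 + 1) → GaugeConfig 3 L SU2), x.2.2) 1) ^ 2 +
      (seamIm L ((Fin.cons (glue x.1) x.2.1 : Fin (2 * L - 1 + 1) → GaugeConfig 3 L SU2), x.2.2) 2) ^ 2 ≤ 1 / 2 := by
  set P : (Fin (2 * L - 1 + 1) → GaugeConfig 3 L SU2) × (Site 3 L → SU2) :=
    ((Fin.cons (glue x.1) x.2.1 : Fin (2 * L - 1 + 1) → GaugeConfig 3 L SU2), x.2.2) with hPdef
  set z := seamIm L P with hzdef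
  have hP0 : P.1 0 = glue x.1 := by simp [hPdef]
  have ht : treeGauge (P.1 0) = 1 := by rw [hP0]; funext y; exact treeGauge_glue x.1 y
  set q := su2Quat (P.2 0) with hqdef
  have hprox := norm_sq_seam_sub_lift_seamIm_le P ht hσ₄ hhem
  have hF0 : 0 ≤ ringDeficit L (fun _ => false) P := ringDeficit_nonneg _ _
  have hw := window_sqrt_le (L := L) hF
  have hn : ‖q - liftQuat σ₄ z‖ ≤ 1 / 5 := by
    have h2 : ‖q - liftQuat σ₄ z‖ ^ 2 ≤ (Real.sqrt 17 * (12 * (L : ℝ) ^ 2 * Real.sqrt (ringDeficit L (fun _ => false) P))) ^ 2 := by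
      rw [mul_pow, Real.sq_sqrt (by norm_num)]; exact hprox
    have h3 := (pow_le_pow_iff_left₀ (norm_nonneg _) (by positivity) two_ne_zero).1 h2
    have h50 := sqrt17_bounds.2
    have hs0 : 0 ≤ (L : ℝ) ^ 2 * Real.sqrt (ringDeficit L (fun _ => false) P) := by positivity
    nlinarith [h3, h50, hs0, hw]
  have him := im_sub_sq_le_norm_sub_sq q (liftQuat σ₄ z)
  have hd : ((su2Quat (P.2 0)).imI - z 0) ^ 2 + ((su2Quat (P.2 0)).imJ - z 1) ^ 2 + ((su2Quat (P.2 0)).imK - z 2) ^ 2 ≤ 1 / 25 := by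
    have h5 : ‖q - liftQuat σ₄ z‖ ^ 2 ≤ (1 / 5) ^ 2 := pow_le_pow_left₀ (norm_nonneg _) hn 2
    have e1 : (liftQuat σ₄ z).imI = z 0 := rfl
    have e2 : (liftQuat σ₄ z).imJ = z 1 := rfl
    have e3 : (liftQuat σ₄ z).imK = z 2 := rfl
    rw [e1, e2, e3] at him
    linarith
  have ha : (su2Quat (P.2 0)).imI ^ 2 + (su2Quat (P.2 0)).imJ ^ 2 + (su2Quat (P.2 0)).imK ^ 2 ≤ 1 / 4 := by
    rw [im_sq_eq_mass]; exact hmass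
  exact sq3_le_half ha hd

/-! ## §2 (P4) in package shape -/

/-- ★★ **(P4) at the slice-0 wrap links, package shape**: sign hypothesis, `m_k ≤ ¼`, `F_fix ≤ (110000·L⁴)⁻¹` ⇒
`−330L²·√F_fix ≤ Σ_va centralCoeff L σ σ₄ va M_x·∂_va m_k(M_x)`. [cite: Luscher1983, §2] -/
theorem central_linkMass_bracket_lower_window {σ : Fin 3 → ℝ} (hσ : ∀ k, σ k = 1 ∨ σ k = -1) (σ₄ : ℝ)
    (x : (OffIdx L → SU2) × ((Fin (2 * L - 1) → GaugeConfig 3 L SU2) × (Site 3 L → SU2))) (k : Fin 3)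
    (hhem : (1 / 2 : ℝ) ≤ σ k * (su2Quat (wrapReps ((Fin.cons (glue x.1) x.2.1 : Fin (2 * L - 1 + 1) → GaugeConfig 3 L SU2) 0) k)).re)
    (hmass : 1 - (su2Quat (wrapReps ((Fin.cons (glue x.1) x.2.1 : Fin (2 * L - 1 + 1) → GaugeConfig 3 L SU2) 0) k)).re ^ 2 ≤ 1 / 4)
    (hF : ringDeficit L (fun _ => false) ((Fin.cons (glue x.1) x.2.1 : Fin (2 * L - 1 + 1) → GaugeConfig 3 L SU2), x.2.2) ≤ (110000 * (L : ℝ) ^ 4)⁻¹) :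
    -(330 * (L : ℝ) ^ 2 * Real.sqrt (ringDeficit L (fun _ => false) ((Fin.cons (glue x.1) x.2.1 : Fin (2 * L - 1 + 1) → GaugeConfig 3 L SU2), x.2.2))) ≤
      ∑ va, centralCoeff L σ σ₄ va (ringCoord L ((Fin.cons (glue x.1) x.2.1 : Fin (2 * L - 1 + 1) → GaugeConfig 3 L SU2), x.2.2)) *
        frameD (fixFrameStd va) (linkMass k) (ringCoord L ((Fin.cons (glue x.1) x.2.1 : Fin (2 * L - 1 + 1) → GaugeConfig 3 L SU2), x.2.2)) :=
  central_linkMass_bracket_lower hσ σ₄ x k hhem (blockIm_sq_le_half_of_window (hσ k) x k hhem hmass hF)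

/-- ★★ **(P4) at the seam root, package shape.** [cite: Luscher1983, §2] -/
theorem central_seamMass_bracket_lower_window (σ : Fin 3 → ℝ) {σ₄ : ℝ} (hσ₄ : σ₄ = 1 ∨ σ₄ = -1)
    (x : (OffIdx L → SU2) × ((Fin (2 * L - 1) → GaugeConfig 3 L SU2) × (Site 3 L → SU2)))
    (hhem : (1 / 2 : ℝ) ≤ σ₄ * (su2Quat (x.2.2 0)).re) (hmass : 1 - (su2Quat (x.2.2 0)).re ^ 2 ≤ 1 / 4)
    (hF : ringDeficit L (fun _ => false) ((Fin.cons (glue x.1) x.2.1 : Fin (2 * L - 1 + 1) → GaugeConfig 3 L SU2), x.2.2) ≤ (110000 * (L : ℝ) ^ 4)⁻¹) :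
    -(330 * (L : ℝ) ^ 2 * Real.sqrt (ringDeficit L (fun _ => false) ((Fin.cons (glue x.1) x.2.1 : Fin (2 * L - 1 + 1) → GaugeConfig 3 L SU2), x.2.2))) ≤
      ∑ va, centralCoeff L σ σ₄ va (ringCoord L ((Fin.cons (glue x.1) x.2.1 : Fin (2 * L - 1 + 1) → GaugeConfig 3 L SU2), x.2.2)) *
        frameD (fixFrameStd va) seamMass (ringCoord L ((Fin.cons (glue x.1) x.2.1 : Fin (2 * L - 1 + 1) → GaugeConfig 3 L SU2), x.2.2)) :=
  central_seamMass_bracket_lower σ hσ₄ x hhem (seamIm_sq_le_half_of_window hσ₄ x hhem hmass hF)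

end Summit.QuantumFields.YangMills.Theorems.VirialFluxGap.FrameHessian

end
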